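import Summits.HodgeConjecture.HodgeCM.Automorphic.ThetaCarrierRep_1

/-! PORT of `HodgeCM/Automorphic/ThetaCarrierRep.lean` (HodgeCMPerL run 82) — part 2: continuation of `Summits.HodgeConjecture.HodgeCM.Automorphic.ThetaCarrierRep_1` (split at a top-level declaration boundary by port_pkg.py; scope re-opened below; declarations unchanged). -/

-- port_pkg: scope re-opened for this part (file-level context, then the namespace/section stack open at the cut)
set_option autoImplicit false
noncomputable section
open scoped InnerProductSpace ComplexConjugate
namespace HodgeCM
open HodgeCM.Prior.Perl34File HodgeCM.Prior.Perl34File.Perl34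
namespace Assembly
open HodgeCM.PerL34 HodgeCM.PerL34.ArchC
open HodgeCM.Universe (RepThetaCarrier ThetaModel)
variable (U : Universe)
/-- **Both realisation inputs over a representation-theoretic carrier** (the prl1 target pair):
`realisationExists_ofCarrier` at `D.toThetaCarrier`.  Hypotheses: model facts `M`, the FIFTEEN analytic axioms per
context `hA`, the ten theta inputs `A`, Hodge–Riemann for `(2,0)`-forms. -/
theorem realisationExists_ofRepCarrier (M : U.ModelAxioms) (D : U.RepThetaCarrier) (hA : D.Analytic)
    (A : (ThetaModel.ofRepCarrier D hA).Inputs) (hHR : U.Fact_hodgeRiemann20) :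
    U.RealisationExistsPerL ∧ U.RealisationExistsFace :=
  realisationExists_ofCarrier U M D.toThetaCarrier hA.toThetaCarrier A hHR

/-- **PerL over a representation-theoretic carrier.** -/
theorem perL_ofRepCarrier (M : U.ModelAxioms) (D : U.RepThetaCarrier) (hA : D.Analytic)
    (A : (ThetaModel.ofRepCarrier D hA).Inputs) (hHR : U.Fact_hodgeRiemann20) : U.PerL :=
  perL_ofCarrier U M D.toThetaCarrier hA.toThetaCarrier A hHR

/-- **COR-CM, END STATE over a representation-theoretic carrier.** -/
theorem COR_CM_endState_ofRepCarrier (M : U.ModelAxioms) (h29 : U.Fact_weightSpan) (h30 : U.Fact_weightHodge)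
    (hE : U.Qw8ExtProd) (hD : U.Qw8DualPushPull) (hMi : U.Qw8Milne) (D : U.RepThetaCarrier) (hA : D.Analytic)
    (A : (ThetaModel.ofRepCarrier D hA).Inputs) (hHR : U.Fact_hodgeRiemann20) : U.HC_CM :=
  COR_CM_endState_ofCarrier U M h29 h30 hE hD hMi D.toThetaCarrier hA.toThetaCarrier A hHR

/-- **COR-CM, END STATE over a representation-theoretic carrier, from the leaves**:
`COR_CM_endState_ofCarrier_leaves'` at `D.toThetaCarrier` — no prop-carrying data binder, no `Inputs` record, and
fifteen (not twenty) analytic axioms per seesaw context. -/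
theorem COR_CM_endState_ofRepCarrier_leaves' (M : U.ModelAxioms) (h29 : U.Fact_weightSpan)
    (h30 : U.Fact_weightHodge) (hE : U.Qw8ExtProd) (hD : U.Qw8DualPushPull) (hMi : U.Qw8Milne)
    (D : U.RepThetaCarrier) (hA : D.Analytic)
    (h07 : N07_hodgeRiemann20 U) (h09a : N09a_embCover (ThetaModel.ofRepCarrier D hA))
    (h09b : N09b_innerEmb (ThetaModel.ofRepCarrier D hA))
    (h12a : N12a_thetaSub (ThetaModel.ofRepCarrier D hA)) (h12b : N12b_signRecipe (ThetaModel.ofRepCarrier D hA))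
    (hgen : ∀ {L : CMField} {ι₁ : L →+* ℂ} (V : HermSpace3 L ι₁) (c : SeesawCtx L),
      (ThetaModel.ofRepCarrier D hA).GoodCtx ι₁ c →
      N19w_genIdentity (ThetaModel.ofRepCarrier D hA) V c ((ThetaModel.ofRepCarrier D hA).t12 V c) 0 1)
    (hcore : ∀ {L : CMField} {ι₁ : L →+* ℂ} (V : HermSpace3 L ι₁) (c : SeesawCtx L),
      (ThetaModel.ofRepCarrier D hA).GoodCtx ι₁ c →
      N19g_core (ThetaModel.ofRepCarrier D hA) V c ((ThetaModel.ofRepCarrier D hA).t34 V c) 2 3)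
    (Pc : ∀ {L : CMField} {ι₁ : L →+* ℂ} (V : HermSpace3 L ι₁) (c : SeesawCtx L),
      C4a.PointedCore ((ThetaModel.ofRepCarrier D hA).core V c))
    (A12 : ∀ {L : CMField} {ι₁ : L →+* ℂ} (V : HermSpace3 L ι₁) (c : SeesawCtx L),
      (ThetaModel.ofRepCarrier D hA).GoodCtx ι₁ c →
      Nonempty (ArchCDatum ((ThetaModel.ofRepCarrier D hA).core V c) ((ThetaModel.ofRepCarrier D hA).t12 V c)
        (Pc V c)))
    (A34 : ∀ {L : CMField} {ι₁ : L →+* ℂ} (V : HermSpace3 L ι₁) (c : SeesawCtx L),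
      (ThetaModel.ofRepCarrier D hA).GoodCtx ι₁ c →
      Nonempty (ArchCDatum ((ThetaModel.ofRepCarrier D hA).core V c) ((ThetaModel.ofRepCarrier D hA).t34 V c)
        (Pc V c)))
    (h31 : ClusterOutputs (ThetaModel.ofRepCarrier D hA))
    (h33 : WedgeToClasses.StepsPrintInput (ThetaModel.ofRepCarrier D hA)) : U.HC_CM :=
  COR_CM_endState_ofCarrier_leaves' U M h29 h30 hE hD hMi D.toThetaCarrier hA.toThetaCarrier h07 h09a h09b h12a
    h12b hgen hcore Pc A12 A34 h31 h33

end Assembly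

end HodgeCM

end
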